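import Literature.NumberTheory.LFunctions.WeilZeroSum
import Literature.NumberTheory.LFunctions.SelbergDeltaAssembly
import Mathlib.Analysis.Normed.Group.Tannery
import HarnessLib

/-!
# Dominated convergence on the zero side of the explicit formula

Stub `stub_zeroSideLimit` of the line "Sketch (heat cone)" for the crux
`Summit.RiemannHypothesis.RiemannHypothesis.Theses.RuelleBand.ExactFirstBand`.  The line proves the
Guinand–Weil explicit formula for the Gaussian test function by cut-off approximation of the
tree's theorem for compactly supported tests; on the zero side this produces sums
`Σ_ρ m(ρ) F_R(ρ)` over the non-trivial zeros of `ζ` (multiplicity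
`m(ρ) = riemannZetaZeroOrder ρ ≥ 0`) with a uniform bound `|F_R(ρ)| ≤ D/(1+γ²)` (`γ = Im ρ`,
`R ≥ 1`) and pointwise convergence `F_R(ρ) → F_∞(ρ)`.  This file is the abstract dominated
convergence statement: then `Σ_ρ ‖m(ρ) F_∞(ρ)‖ < ∞` and `Σ_ρ m(ρ) F_R(ρ) → Σ_ρ m(ρ) F_∞(ρ)` as
`R → ∞` (Tannery's theorem, `tendsto_tsum_of_dominated_convergence`, with the dominating sequence
`|D| m(ρ)/(1+γ²)`).

The key input is the unconditional summability `Σ_ρ m(ρ)/(1+γ²) < ∞` over the non-trivial zeros,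
which is the tree's
`Literature.NumberTheory.LFunctions.SelbergDelta.summable_zeroOrder_div_one_add_im_sq`
(`SelbergDeltaAssembly.lean`; from `Σ m(ρ)/|ρ|² < ∞` over the zeros with `Re ρ ≥ 1/4`,
`Literature.NumberTheory.LFunctions.summable_zeroOrder_div_norm_sq`, Jensen, and the reflection
`ρ ↦ 1 - ρ̄` for the others).
-/

set_option linter.dupNamespace false

noncomputable section

open Complex MeasureTheory Filter Set
open scoped Topology

namespace Summit.RiemannHypothesis.RiemannHypothesis.Theorems.RuelleBandExactFirstBand

open Literature.NumberTheory.LFunctions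

/-- **Dominated convergence on the zero side (abstract family).** If `F R ρ` is bounded by
`D/(1+γ²)` uniformly in `R ≥ 1` on the non-trivial zeros and converges pointwise to `F∞ ρ` as
`R → ∞`, then `Σ_ρ m(ρ) F R ρ → Σ_ρ m(ρ) F∞ ρ` and the limit is absolutely summable.  Proof:
Tannery's theorem `tendsto_tsum_of_dominated_convergence` with the summable dominating sequence
`|D| · m(ρ)/(1+γ²)` (`SelbergDelta.summable_zeroOrder_div_one_add_im_sq`; `‖m(ρ) x‖ = m(ρ)‖x‖`
as `m(ρ) ≥ 0`), and `‖m(ρ) F∞ ρ‖ ≤ |D| m(ρ)/(1+γ²)` by passing to the limit in the eventual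
bound. -/
theorem stub_zeroSideLimit :
    ∀ (F : ℝ → ℂ → ℂ) (Finf : ℂ → ℂ) (D : ℝ),
      (∀ R : ℝ, 1 ≤ R → ∀ ρ ∈ ZetaZeros.riemannZetaNontrivialZeros, ‖F R ρ‖ ≤ D / (1 + ρ.im ^ 2)) →
      (∀ ρ ∈ ZetaZeros.riemannZetaNontrivialZeros, Tendsto (fun R : ℝ => F R ρ) atTop (𝓝 (Finf ρ))) →
      Summable (fun ρ : ZetaZeros.riemannZetaNontrivialZeros =>
          ‖(riemannZetaZeroOrder (ρ : ℂ) : ℂ) * Finf ρ‖) ∧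
        Tendsto (fun R : ℝ => ∑' ρ : ZetaZeros.riemannZetaNontrivialZeros,
            (riemannZetaZeroOrder (ρ : ℂ) : ℂ) * F R ρ) atTop
          (𝓝 (∑' ρ : ZetaZeros.riemannZetaNontrivialZeros, (riemannZetaZeroOrder (ρ : ℂ) : ℂ) * Finf ρ)) := by
  intro F Finf D hB hF
  have h_sum : Summable fun ρ : ZetaZeros.riemannZetaNontrivialZeros =>
      |D| * ((riemannZetaZeroOrder (ρ : ℂ) : ℝ) / (1 + (ρ : ℂ).im ^ 2)) :=
    SelbergDelta.summable_zeroOrder_div_one_add_im_sq.mul_left |D|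
  have hm : ∀ ρ : ZetaZeros.riemannZetaNontrivialZeros, (0 : ℝ) ≤ riemannZetaZeroOrder (ρ : ℂ) :=
    fun ρ => by
      exact_mod_cast riemannZetaZeroOrder_nonneg (ZetaZeros.riemannZetaNontrivialZeros.ne_one ρ.2)
  have h_bound : ∀ᶠ R : ℝ in atTop, ∀ ρ : ZetaZeros.riemannZetaNontrivialZeros,
      ‖(riemannZetaZeroOrder (ρ : ℂ) : ℂ) * F R ρ‖ ≤
        |D| * ((riemannZetaZeroOrder (ρ : ℂ) : ℝ) / (1 + (ρ : ℂ).im ^ 2)) := by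
    filter_upwards [eventually_ge_atTop (1 : ℝ)] with R hR ρ
    rw [norm_mul, Complex.norm_intCast, abs_of_nonneg (hm ρ)]
    calc (riemannZetaZeroOrder (ρ : ℂ) : ℝ) * ‖F R ρ‖
        ≤ (riemannZetaZeroOrder (ρ : ℂ) : ℝ) * (|D| / (1 + (ρ : ℂ).im ^ 2)) := by
          refine mul_le_mul_of_nonneg_left ((hB R hR ρ ρ.2).trans ?_) (hm ρ)
          exact div_le_div_of_nonneg_right (le_abs_self D) (by positivity)
      _ = |D| * ((riemannZetaZeroOrder (ρ : ℂ) : ℝ) / (1 + (ρ : ℂ).im ^ 2)) := by ring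
  have hab : ∀ ρ : ZetaZeros.riemannZetaNontrivialZeros,
      Tendsto (fun R : ℝ => (riemannZetaZeroOrder (ρ : ℂ) : ℂ) * F R ρ) atTop
        (𝓝 ((riemannZetaZeroOrder (ρ : ℂ) : ℂ) * Finf ρ)) :=
    fun ρ => (hF ρ ρ.2).const_mul _
  refine ⟨?_, tendsto_tsum_of_dominated_convergence h_sum hab h_bound⟩
  refine Summable.of_nonneg_of_le (fun _ => norm_nonneg _) (fun ρ => ?_) h_sum
  exact le_of_tendsto (hab ρ).norm (h_bound.mono fun R h => h ρ)

end Summit.RiemannHypothesis.RiemannHypothesis.Theorems.RuelleBandExactFirstBand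

end
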